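import Mathlib
import Literature.Analysis.Pluripotential.Vesentini
import Literature.Analysis.Pluripotential.SubharmonicMaxPrinciple
import HarnessLib

/-!
# Proof of Vesentini's theorem (`Ransford1995_thm_6_4_2`)

Discharges the named fact `Literature.Analysis.Pluripotential.Ransford1995_thm_6_4_2`
(T. Ransford, *Potential Theory in the Complex Plane* (1995), Thm. 6.4.2): for a holomorphic
function `f : U → A` into a complex Banach algebra, `z ↦ log ρ(f(z))` is subharmonic on `U`,
following the printed proof:

* `average_le_circleMean` — comparison of the tree's `[-∞,+∞]`-valued circle mean with the
  average of a real integrable a.e.-minorant (companion of `circleMean_le_average`);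
* `isSubharmonicOn_log_enorm` — Ransford's Lemma 6.4.1: `log ‖f‖` is subharmonic for a
  holomorphic Banach-space-valued `f` (Hahn–Banach functional `φ` with `φ(f(c)) = ‖f(c)‖`, then
  Jensen's formula `AnalyticOnNhd.circleAverage_log_norm` for the scalar function `φ ∘ f`);
* `IsSubharmonicOn.of_antitone_tendsto` — Ransford's Thm. 2.4.6 for decreasing sequences
  (monotone/dominated convergence of the positive and negative parts of the circle means);
* `Ransford1995_thm_6_4_2_holds` — Vesentini: `u_k = 2^{-k} log ‖f^{2^k}‖` decreases to
  `log ρ(f)` by the spectral radius formula (`spectrum.gelfand_formula`).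
-/

noncomputable section

open scoped Topology ENNReal
open MeasureTheory Filter Set Metric

namespace Literature.Analysis.Pluripotential

variable {u : ℂ → EReal} {c : ℂ} {R : ℝ}

/-! ### Comparison of the circle mean with a real a.e.-minorant -/

/-- **Comparison with a real minorant**: if `h θ ≤ u (c + R e^{iθ})` for a.e. `θ ∈ (0, 2π]` with
`h` integrable, then `(2π)⁻¹ ∫₀^{2π} h ≤ (2π)⁻¹ ∫ u`. [folklore] -/
theorem average_le_circleMean {h : ℝ → ℝ} (hh : IntegrableOn h (Ioc 0 (2 * Real.pi)))
    (hle : ∀ᵐ θ ∂(volume.restrict (Ioc (0 : ℝ) (2 * Real.pi))),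
      ((h θ : ℝ) : EReal) ≤ u (circleMap c R θ)) :
    (((∫ θ in Ioc (0 : ℝ) (2 * Real.pi), h θ) / (2 * Real.pi) : ℝ) : EReal) ≤ circleMean u c R := by
  have hpi : 0 < 2 * Real.pi := by positivity
  set A := ∫⁻ θ in Ioc (0 : ℝ) (2 * Real.pi), ENNReal.ofReal (h θ) with hA_def
  set B := ∫⁻ θ in Ioc (0 : ℝ) (2 * Real.pi), ENNReal.ofReal (-h θ) with hB_def
  have hA : A < ⊤ := by
    refine lt_of_le_of_lt (lintegral_mono fun θ ↦ ?_) hh.hasFiniteIntegral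
    exact Real.ofReal_le_enorm (h θ)
  have hB : B < ⊤ := by
    refine lt_of_le_of_lt (lintegral_mono fun θ ↦ ?_) hh.neg.hasFiniteIntegral
    exact Real.ofReal_le_enorm (-h θ)
  have hint : ∫ θ in Ioc (0 : ℝ) (2 * Real.pi), h θ = A.toReal - B.toReal :=
    integral_eq_lintegral_pos_part_sub_lintegral_neg_part hh
  have hup : A / ENNReal.ofReal (2 * Real.pi) ≤ circleUpperMean u c R := by
    unfold circleUpperMean
    gcongr ?_ / _
    refine lintegral_mono_ae (hle.mono fun θ hθ ↦ ?_)
    exact (EReal.real_coe_toENNReal _).symm.le.trans (EReal.toENNReal_le_toENNReal hθ)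
  have hlo : circleLowerMean u c R ≤ B / ENNReal.ofReal (2 * Real.pi) := by
    unfold circleLowerMean
    gcongr ?_ / _
    refine lintegral_mono_ae (hle.mono fun θ hθ ↦ ?_)
    rw [← EReal.real_coe_toENNReal, EReal.coe_neg]
    exact EReal.toENNReal_le_toENNReal (EReal.neg_le_neg_iff.2 hθ)
  have hp : ENNReal.ofReal (2 * Real.pi) ≠ 0 := (ENNReal.ofReal_pos.2 hpi).ne'
  have hA' : A / ENNReal.ofReal (2 * Real.pi) ≠ ⊤ := ENNReal.div_ne_top hA.ne hp
  have hB' : B / ENNReal.ofReal (2 * Real.pi) ≠ ⊤ := ENNReal.div_ne_top hB.ne hp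
  calc (((∫ θ in Ioc (0 : ℝ) (2 * Real.pi), h θ) / (2 * Real.pi) : ℝ) : EReal)
      = ((A / ENNReal.ofReal (2 * Real.pi) : ℝ≥0∞) : EReal) -
          ((B / ENNReal.ofReal (2 * Real.pi) : ℝ≥0∞) : EReal) := by
        rw [← EReal.coe_ennreal_toReal hA', ← EReal.coe_ennreal_toReal hB', ← EReal.coe_sub,
          ENNReal.toReal_div, ENNReal.toReal_div, ENNReal.toReal_ofReal hpi.le, ← sub_div, ← hint]
    _ ≤ circleMean u c R :=
        EReal.sub_le_sub (EReal.coe_ennreal_le_coe_ennreal_iff.2 hup)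
          (EReal.coe_ennreal_le_coe_ennreal_iff.2 hlo)

/-! ### Ransford's Lemma 6.4.1: `log ‖f‖` is subharmonic for holomorphic Banach-valued `f` -/

/-- **Ransford, Lemma 6.4.1** (vector-valued form of Thm. 2.2.2): if `f : U → X` is holomorphic
on the open set `U ⊆ ℂ` with values in a complex normed space, then `log ‖f‖` (value `-∞` where
`f = 0`) is subharmonic on `U`. Proof: at a centre `c` with `f(c) ≠ 0` take a norming functional
`φ` (`‖φ‖ = 1`, `φ(f(c)) = ‖f(c)‖`, Hahn–Banach); Jensen's formula for the scalar holomorphic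
function `φ ∘ f` gives `log ‖f(c)‖ = log |φ(f(c))| ≤ (2π)⁻¹ ∫ log |φ ∘ f| ≤ (2π)⁻¹ ∫ log ‖f‖`.
[cite: Ransford1995, Lemma 6.4.1] -/
theorem isSubharmonicOn_log_enorm {X : Type*} [NormedAddCommGroup X] [NormedSpace ℂ X]
    {U : Set ℂ} (hU : IsOpen U) {f : ℂ → X} (hf : DifferentiableOn ℂ f U) :
    IsSubharmonicOn (fun z => ENNReal.log ‖f z‖ₑ) U := by
  refine ⟨?_, fun z _ => ?_, ?_⟩
  · -- upper semicontinuity (indeed continuity) of `log ‖f‖` on `U`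
    have hc : ContinuousOn (fun z => ENNReal.log ‖f z‖ₑ) U :=
      ENNReal.continuous_log.comp_continuousOn (continuous_enorm.comp_continuousOn hf.continuousOn)
    exact fun z hz => (hc z hz).upperSemicontinuousWithinAt
  · -- finiteness
    rw [lt_top_iff_ne_top, Ne, ENNReal.log_eq_top_iff]
    exact enorm_ne_top
  · intro c R hR hsub
    by_cases h0 : f c = 0
    · simp [h0]
    -- a norming functional
    have hn0 : ‖f c‖ ≠ 0 := by simpa using h0
    obtain ⟨φ, hφ1, hφc⟩ := exists_dual_vector ℂ (f c) hn0
    set g : ℂ → ℂ := fun z => φ (f z) with hg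
    have hgd : DifferentiableOn ℂ g U := φ.differentiable.comp_differentiableOn hf
    have hgU : AnalyticOnNhd ℂ g U := hgd.analyticOnNhd hU
    have habs : |R| = R := abs_of_pos hR
    have hga : AnalyticOnNhd ℂ g (closedBall c |R|) := hgU.mono (by rwa [habs])
    have hgc : g c ≠ 0 := by
      simp only [hg, hφc, ne_eq]
      exact Complex.ofReal_ne_zero.mpr hn0
    -- Jensen: `log ‖g c‖ ≤ circleAverage (log ‖g‖)`
    have hJ := AnalyticOnNhd.circleAverage_log_norm hR.ne' hga hgc
    have hsum : 0 ≤ ∑ᶠ u, (MeromorphicOn.divisor g (closedBall c |R|) u : ℝ) *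
        Real.log (R * ‖c - u‖⁻¹) := by
      refine finsum_nonneg fun u => ?_
      by_cases hdu : MeromorphicOn.divisor g (closedBall c |R|) u = 0
      · simp [hdu]
      · have hu : u ∈ closedBall c |R| :=
          (MeromorphicOn.divisor g (closedBall c |R|)).supportWithinDomain hdu
        have hdn : (0 : ℤ) ≤ MeromorphicOn.divisor g (closedBall c |R|) u :=
          MeromorphicOn.AnalyticOnNhd.divisor_nonneg hga u
        refine mul_nonneg (by exact_mod_cast hdn) ?_
        by_cases hcu : ‖c - u‖ = 0
        · simp [hcu]
        · refine Real.log_nonneg ?_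
          rw [mem_closedBall, dist_comm, dist_eq_norm, habs] at hu
          rw [le_mul_inv_iff₀ (lt_of_le_of_ne (norm_nonneg _) (Ne.symm hcu)), one_mul]
          exact hu
    have hlogc : Real.log ‖f c‖ ≤ Real.circleAverage (fun z => Real.log ‖g z‖) c R := by
      have : Real.log ‖g c‖ = Real.log ‖f c‖ := by simp [hg, hφc]
      rw [hJ, this]
      linarith
    -- `g ≠ 0` off a discrete subset of the closed disc, hence a.e. on the circle
    have hne : ∀ᶠ z in codiscreteWithin (closedBall c |R|), g z ≠ 0 := by
      rcases hga.eqOn_zero_or_eventually_ne_zero_of_preconnected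
        (convex_closedBall c |R|).isPreconnected with h | h
      · exact absurd (h (mem_closedBall_self (abs_nonneg R))) hgc
      · exact h
    have hne' : ∀ᶠ z in codiscreteWithin (sphere c |R|), g z ≠ 0 :=
      Filter.codiscreteWithin_mono sphere_subset_closedBall hne
    have hae : ∀ᵐ θ ∂(volume.restrict (Ioc (0 : ℝ) (2 * Real.pi))), g (circleMap c R θ) ≠ 0 := by
      have h1 : ∀ᶠ θ in codiscreteWithin (Set.uIoc 0 (2 * Real.pi)), g (circleMap c R θ) ≠ 0 :=
        codiscreteWithin_mono (by tauto) (circleMap_preimage_codiscrete hR.ne' hne')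
      have h2 : ∀ᵐ θ ∂(volume.restrict (Set.uIoc (0 : ℝ) (2 * Real.pi))), g (circleMap c R θ) ≠ 0 :=
        ae_restrict_le_codiscreteWithin measurableSet_uIoc h1
      rwa [uIoc_of_le (by positivity : (0:ℝ) ≤ 2 * Real.pi)] at h2
    -- pointwise comparison `log |g| ≤ log ‖f‖` where `g ≠ 0`
    have hcmp : ∀ᵐ θ ∂(volume.restrict (Ioc (0 : ℝ) (2 * Real.pi))),
        ((Real.log ‖g (circleMap c R θ)‖ : ℝ) : EReal) ≤ ENNReal.log ‖f (circleMap c R θ)‖ₑ := by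
      filter_upwards [hae] with θ hθ
      have hgle : ‖g (circleMap c R θ)‖ ≤ ‖f (circleMap c R θ)‖ := by
        calc ‖g (circleMap c R θ)‖ ≤ ‖φ‖ * ‖f (circleMap c R θ)‖ := φ.le_opNorm _
          _ = ‖f (circleMap c R θ)‖ := by rw [hφ1, one_mul]
      have hgpos : 0 < ‖g (circleMap c R θ)‖ := norm_pos_iff.mpr hθ
      have hfpos : 0 < ‖f (circleMap c R θ)‖ := hgpos.trans_le hgle
      rw [← ofReal_norm, ENNReal.log_ofReal_of_pos hfpos, EReal.coe_le_coe_iff]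
      exact Real.log_le_log hgpos hgle
    -- integrability of `log |g|` on the circle
    have hint : IntegrableOn (fun θ => Real.log ‖g (circleMap c R θ)‖) (Ioc 0 (2 * Real.pi)) := by
      have hm : MeromorphicOn g (sphere c |R|) := (hga.mono sphere_subset_closedBall).meromorphicOn
      have := hm.circleIntegrable_log_norm
      rw [CircleIntegrable, intervalIntegrable_iff_integrableOn_Ioc_of_le (by positivity)] at this
      exact this
    -- assemble
    have hav : Real.circleAverage (fun z => Real.log ‖g z‖) c R =
        (∫ θ in Ioc (0 : ℝ) (2 * Real.pi), Real.log ‖g (circleMap c R θ)‖) / (2 * Real.pi) := by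
      rw [Real.circleAverage_def, intervalIntegral.integral_of_le (by positivity), smul_eq_mul]
      ring
    have hkey := average_le_circleMean (u := fun z => ENNReal.log ‖f z‖ₑ) (c := c) (R := R) hint hcmp
    rw [← hav] at hkey
    refine le_trans ?_ hkey
    show ENNReal.log ‖f c‖ₑ ≤ _
    rw [← ofReal_norm, ENNReal.log_ofReal_of_pos (norm_pos_iff.mpr h0), EReal.coe_le_coe_iff]
    exact hlogc

/-! ### Ransford's Theorem 2.4.6 for decreasing sequences -/

/-- **Ransford, Thm. 2.4.6 (decreasing limits)**: if `v₀ ≥ v₁ ≥ ⋯` are subharmonic on `U`, then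
their pointwise infimum (= limit) is subharmonic on `U`. (Upper semicontinuity of an infimum of
u.s.c. functions; the circle means of `vₙ` decrease to the circle mean of the limit by the
monotone convergence theorems for the positive parts — dominated by `v₀⁺`, which has finite
integral — and for the negative parts.) [cite: Ransford1995, Thm 2.4.6] -/
theorem isSubharmonicOn_of_antitone {U : Set ℂ} {v : ℕ → ℂ → EReal} {u : ℂ → EReal}
    (hv : ∀ n, IsSubharmonicOn (v n) U) (hanti : ∀ z ∈ U, Antitone fun n => v n z)
    (hu : ∀ z ∈ U, u z = ⨅ n, v n z) : IsSubharmonicOn u U := by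
  refine ⟨?_, fun z hz => ?_, ?_⟩
  · -- upper semicontinuity of the infimum
    intro z hz a ha
    rw [hu z hz] at ha
    obtain ⟨n, hn⟩ := iInf_lt_iff.mp ha
    filter_upwards [(hv n).1 z hz a hn, self_mem_nhdsWithin] with w hw hwU
    rw [hu w hwU]
    exact (iInf_le _ n).trans_lt hw
  · rw [hu z hz]
    exact (iInf_le _ 0).trans_lt ((hv 0).lt_top hz)
  · intro c R hR hsub
    have hcU : c ∈ U := hsub (mem_closedBall_self hR.le)
    have hmem : ∀ θ : ℝ, circleMap c R θ ∈ U := fun θ =>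
      hsub (circleMap_mem_closedBall c hR.le θ)
    -- traces on the circle
    set F : ℕ → ℝ → EReal := fun n θ => v n (circleMap c R θ) with hF
    have hFmeas : ∀ n, Measurable (F n) := fun n => measurable_comp_circleMap (hv n).1 hmem
    have hFanti : ∀ θ, Antitone fun n => F n θ := fun θ => hanti _ (hmem θ)
    have huF : ∀ θ, u (circleMap c R θ) = ⨅ n, F n θ := fun θ => hu _ (hmem θ)
    obtain ⟨C, hC⟩ := exists_forall_comp_circleMap_le (hv 0).1 (fun z hz => (hv 0).lt_top hz) hmem
    -- positive parts: dominated monotone convergence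
    set P : ℕ → ℝ≥0∞ := fun n => ∫⁻ θ in Ioc (0 : ℝ) (2 * Real.pi), (F n θ).toENNReal with hP
    have hPanti : Antitone P := fun n m hnm =>
      lintegral_mono fun θ => EReal.toENNReal_le_toENNReal (hFanti θ hnm)
    have hP0 : P 0 ≠ ⊤ := by
      refine ne_of_lt (lt_of_le_of_lt (setLIntegral_mono' measurableSet_Ioc
        (fun θ _ => ?_) : P 0 ≤ ∫⁻ _ in Ioc (0 : ℝ) (2 * Real.pi), ENNReal.ofReal C) ?_)
      · exact (EReal.toENNReal_le_toENNReal (hC θ)).trans_eq (EReal.real_coe_toENNReal C)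
      · rw [setLIntegral_const]
        exact ENNReal.mul_lt_top ENNReal.ofReal_lt_top (measure_Ioc_lt_top)
    have hPlim : ∫⁻ θ in Ioc (0 : ℝ) (2 * Real.pi), (u (circleMap c R θ)).toENNReal = ⨅ n, P n := by
      have h1 : ∀ θ, (u (circleMap c R θ)).toENNReal = ⨅ n, (F n θ).toENNReal := by
        intro θ
        rw [huF]
        exact Monotone.map_iInf_of_continuousAt EReal.continuous_toENNReal.continuousAt
          (fun x y h => EReal.toENNReal_le_toENNReal h) EReal.toENNReal_top
      simp_rw [h1]
      exact lintegral_iInf (fun n => (hFmeas n).ereal_toENNReal)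
        (fun n m hnm θ => EReal.toENNReal_le_toENNReal (hFanti θ hnm)) hP0
    -- negative parts: monotone convergence
    set N : ℕ → ℝ≥0∞ := fun n => ∫⁻ θ in Ioc (0 : ℝ) (2 * Real.pi), (-F n θ).toENNReal with hN
    have hNmono : Monotone N := fun n m hnm =>
      lintegral_mono fun θ => EReal.toENNReal_le_toENNReal (EReal.neg_le_neg_iff.2 (hFanti θ hnm))
    have hNlim : ∫⁻ θ in Ioc (0 : ℝ) (2 * Real.pi), (-u (circleMap c R θ)).toENNReal = ⨆ n, N n := by
      have h1 : ∀ θ, (-u (circleMap c R θ)).toENNReal = ⨆ n, (-F n θ).toENNReal := by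
        intro θ
        rw [huF]
        have := Antitone.map_iInf_of_continuousAt (f := fun x : EReal => (-x).toENNReal)
          (g := fun n => F n θ)
          (EReal.continuous_toENNReal.comp continuous_neg).continuousAt
          (fun x y h => EReal.toENNReal_le_toENNReal (EReal.neg_le_neg_iff.2 h)) (by simp)
        simpa [Function.comp_def] using this
      simp_rw [h1]
      exact lintegral_iSup (fun n => (hFmeas n).neg.ereal_toENNReal)
        (fun n m hnm θ => EReal.toENNReal_le_toENNReal (EReal.neg_le_neg_iff.2 (hFanti θ hnm)))
    -- convergence of the circle means
    set c₀ : ℝ≥0∞ := ENNReal.ofReal (2 * Real.pi) with hc₀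
    have hc₀0 : c₀ ≠ 0 := (ENNReal.ofReal_pos.2 (by positivity)).ne'
    have hcm : ∀ n, circleMean (v n) c R = ((P n / c₀ : ℝ≥0∞) : EReal) - ((N n / c₀ : ℝ≥0∞) : EReal) :=
      fun n => rfl
    have hcmu : circleMean u c R =
        (((⨅ n, P n) / c₀ : ℝ≥0∞) : EReal) - (((⨆ n, N n) / c₀ : ℝ≥0∞) : EReal) := by
      rw [circleMean, circleUpperMean, circleLowerMean, hPlim, hNlim]
    have hA : (⨅ n, P n) / c₀ ≠ ⊤ := ENNReal.div_ne_top (ne_top_of_le_ne_top hP0 (iInf_le _ 0)) hc₀0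
    have hPt : Tendsto (fun n => ((P n / c₀ : ℝ≥0∞) : EReal)) atTop (𝓝 (((⨅ n, P n) / c₀ : ℝ≥0∞) : EReal)) :=
      (continuous_coe_ennreal_ereal.tendsto _).comp
        (ENNReal.Tendsto.div_const (tendsto_atTop_iInf hPanti) (Or.inr hc₀0))
    have hNt : Tendsto (fun n => -((N n / c₀ : ℝ≥0∞) : EReal)) atTop
        (𝓝 (-(((⨆ n, N n) / c₀ : ℝ≥0∞) : EReal))) :=
      (continuous_neg.tendsto _).comp ((continuous_coe_ennreal_ereal.tendsto _).comp
        (ENNReal.Tendsto.div_const (tendsto_atTop_iSup hNmono) (Or.inr hc₀0)))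
    have hadd : ContinuousAt (fun p : EReal × EReal => p.1 + p.2)
        ((((⨅ n, P n) / c₀ : ℝ≥0∞) : EReal), -(((⨆ n, N n) / c₀ : ℝ≥0∞) : EReal)) :=
      EReal.continuousAt_add (Or.inl (fun h => hA (EReal.coe_ennreal_eq_top_iff.1 h)))
        (Or.inl (EReal.coe_ennreal_ne_bot _))
    have hlim : Tendsto (fun n => circleMean (v n) c R) atTop (𝓝 (circleMean u c R)) := by
      rw [hcmu]
      simp_rw [hcm]
      exact hadd.tendsto.comp (hPt.prodMk_nhds hNt)
    have hanti_cm : Antitone fun n => circleMean (v n) c R := fun n m hnm =>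
      circleMean_mono fun θ _ => hanti _ (hmem θ) hnm
    have hinf : ⨅ n, circleMean (v n) c R = circleMean u c R :=
      tendsto_nhds_unique (tendsto_atTop_iInf hanti_cm) hlim
    calc u c = ⨅ n, v n c := hu c hcU
      _ ≤ ⨅ n, circleMean (v n) c R := iInf_mono fun n => (hv n).le_circleMean hR hsub
      _ = circleMean u c R := hinf

/-! ### Vesentini's theorem -/

/-- **Vesentini's theorem, proved** [Ransford1995, Thm. 6.4.2]: for `f : U → A` holomorphic into a
complex Banach algebra, `log ρ(f)` is subharmonic on `U`. As printed: `u_k = 2^{-k} log ‖f^{2^k}‖`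
is subharmonic (`isSubharmonicOn_log_enorm`, Lemma 6.4.1), decreasing in `k`
(`‖a^{2m}‖ ≤ ‖a^m‖²`), and converges to `log ρ(f)` by the spectral radius formula
(`spectrum.gelfand_formula`); conclude by `isSubharmonicOn_of_antitone` (Thm. 2.4.6).
[cite: Ransford1995, Thm 6.4.2] -/
theorem Ransford1995_thm_6_4_2_holds :
    ∀ (A : Type*) [NormedRing A] [NormedAlgebra ℂ A] [CompleteSpace A] (U : Set ℂ) (f : ℂ → A),
      Ransford1995_thm_6_4_2 A U f := by
  intro A _ _ _ U f hU hf
  set v : ℕ → ℂ → EReal := fun k z =>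
    ((((2 : ℝ) ^ k)⁻¹ : ℝ) : EReal) * ENNReal.log ‖f z ^ 2 ^ k‖ₑ with hv
  have hvsub : ∀ k, IsSubharmonicOn (v k) U := fun k =>
    (isSubharmonicOn_log_enorm hU (hf.pow (2 ^ k))).const_mul (by positivity)
  -- the sequence decreases
  have hvanti : ∀ z ∈ U, Antitone fun k => v k z := by
    intro z _
    refine antitone_nat_of_succ_le fun k => ?_
    have hpow : f z ^ 2 ^ (k + 1) = (f z ^ 2 ^ k) ^ 2 := by rw [← pow_mul, pow_succ]
    have hnorm : ‖f z ^ 2 ^ (k + 1)‖ₑ ≤ ‖f z ^ 2 ^ k‖ₑ ^ 2 := by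
      rw [hpow, sq, sq, enorm_eq_nnnorm, enorm_eq_nnnorm, ← ENNReal.coe_mul, ENNReal.coe_le_coe]
      exact nnnorm_mul_le _ _
    have hlog : ENNReal.log ‖f z ^ 2 ^ (k + 1)‖ₑ ≤ (2 : ℕ) * ENNReal.log ‖f z ^ 2 ^ k‖ₑ := by
      rw [← ENNReal.log_pow]
      exact ENNReal.log_monotone hnorm
    simp only [hv]
    calc ((((2 : ℝ) ^ (k + 1))⁻¹ : ℝ) : EReal) * ENNReal.log ‖f z ^ 2 ^ (k + 1)‖ₑ
        ≤ ((((2 : ℝ) ^ (k + 1))⁻¹ : ℝ) : EReal) * ((2 : ℕ) * ENNReal.log ‖f z ^ 2 ^ k‖ₑ) :=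
          monotone_coe_mul_left (by positivity) hlog
      _ = ((((2 : ℝ) ^ k)⁻¹ : ℝ) : EReal) * ENNReal.log ‖f z ^ 2 ^ k‖ₑ := by
          rw [← mul_assoc]
          congr 1
          have : ((2 : ℕ) : EReal) = ((2 : ℝ) : EReal) := rfl
          rw [this, ← EReal.coe_mul]
          congr 1
          rw [pow_succ, mul_inv, mul_assoc, inv_mul_cancel₀ (by norm_num), mul_one]
  -- and converges to `log ρ`
  have hvlim : ∀ z ∈ U, ENNReal.log (spectralRadius ℂ (f z)) = ⨅ k, v k z := by
    intro z hz
    have hg := spectrum.pow_nnnorm_pow_one_div_tendsto_nhds_spectralRadius (f z)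
    have h2 : Tendsto (fun k : ℕ => 2 ^ k) atTop atTop := tendsto_pow_atTop_atTop_of_one_lt one_lt_two
    have h3 := hg.comp h2
    have h4 : Tendsto (fun k : ℕ => ENNReal.log ((‖f z ^ 2 ^ k‖₊ : ℝ≥0∞) ^ (1 / (2 ^ k : ℕ) : ℝ)))
        atTop (𝓝 (ENNReal.log (spectralRadius ℂ (f z)))) :=
      (ENNReal.continuous_log.tendsto _).comp h3
    have h5 : (fun k : ℕ => ENNReal.log ((‖f z ^ 2 ^ k‖₊ : ℝ≥0∞) ^ (1 / (2 ^ k : ℕ) : ℝ))) =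
        fun k => v k z := by
      funext k
      rw [ENNReal.log_rpow, hv]
      simp only []
      congr 1
      push_cast
      rw [one_div]
    rw [h5] at h4
    exact tendsto_nhds_unique h4 (tendsto_atTop_iInf (hvanti z hz))
  exact isSubharmonicOn_of_antitone hvsub hvanti hvlim

end Literature.Analysis.Pluripotential
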